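import Literature.AlgebraicGeometry.HodgeTheory.BettiNumbersEulerCharacteristic
import Literature.AlgebraicGeometry.HodgeTheory.BettiAbelianVarietyPicardNumberBound
import Literature.AlgebraicGeometry.HodgeTheory.BettiProjectiveSpaceHodgeTate
import Literature.AlgebraicGeometry.Surfaces.K3SurfaceHodgeGroupsPicardNumber
import HarnessLib

/-!
# The topological Euler characteristic of the lane's example varieties: `E(A) = 0` for abelian varieties of positive dimension, `E(ℙᴺ) = N + 1`,
# `E(S) = 2 + ρ(S)` for surfaces with `p_g = q = 0`, and `E(S) = 24` for a K3 surface (with `b_3(S) = b_1(S) = 0` from `H¹ = 0` alone)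
# (Yui 2013 §1.4 Example 1; Lange 2023 Cor. 1.1.18 and proof of Thm. 1.7.1; Arapura 2012 Thm. 7.2.2, §11.1; Huybrechts 2016 Ch. 1 §2.4/§3.3)

Family `hodge`, lane `lit-hodgefound` (Track 2 foundations library; Layers A1/A4), layer `Literature/AlgebraicGeometry/HodgeTheory`.  THEOREMS ONLY (no definition,
no named fact, no instance; D-0026 net debt `0`).  Sequel of the seat's g25-#1 `BettiNumbersEulerCharacteristic` (`E(X) := Σ_{k ≤ 2n} (−1)^k b_k(X; ℚ)` as a displayed
sum; Poincaré duality `b_k = b_{2n−k}`; the surface formula `E(S) = 2 − 4q + 2p_g + h^{1,1}`; Hodge–Tate type `E(X) = Σ_p b_{2p}`), evaluated on the example carriers the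
seat's gen-24 files equipped with Betti / Hodge numbers: complex abelian varieties (g24-#9/#11, `b_k(A) = C(2g,k)`), `ℙᴺ_ℂ` (g24-#14, Hodge–Tate with `b_{2p} = 1`), smooth
projective surfaces with `p_g = q = 0` (g24-#6, Hodge–Tate; `ρ = h^{1,1} = b_2`, g24-#10) and K3 surfaces (g24-#12).

THE PRINTS.  N. Yui (2013) [Yui2013] §1.4 Example 1 (held text p0221): (a) elliptic curves «`E(X) = B_0(X) − B_1(X) + B_2(X) = 0`»; (b) K3 surfaces «`E(X) = Σ_{k=0}^{4} (−1)^k B_k(X)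
= 1 + 22 + 1 = 24`».  H. Lange (2023) [Lange2023AbelianVarietiesComplex] §1.1.3 Cor. 1.1.18 (PDF p. 27: `Hⁿ(X, ℤ)` free of rank `C(2g, n)`), §1.7.1 proof of Thm. 1.7.1 (PDF p. 72:
«we used the binomial formula `Σ_{i=0}^{n} (−1)^i C(n,i) = 0` and that `C(0,0) = 1`»).  D. Arapura (2012) [Arapura2012] §7.2 Thm. 7.2.2 (PDF p. 141: `Hⁱ(ℙⁿ, ℤ) = ℤ` for
`0 ≤ i ≤ 2n` even, `0` otherwise), §4.5 Exercise 4.5.5 (PDF p. 95: `e(X) = Σ (−1)ⁱ dim Hⁱ(X, ℝ)`), §11.1 (PDF p. 174: `e = 2 − 4q + 2p_g + h^{11}`; Example 11.1.1: `ℙ²` has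
`q = p_g = 0`, `h^{11} = 1`), §11.2 (PDF p. 177: `ρ ≤ h^{11}`, with equality if `p_g = 0`).  D. Huybrechts (2016) [Huybrechts2016K3] Ch. 1 §3.3 and §2.4 (2.7) (`H¹(X, ℤ) = 0`,
`b_2 = 22 = 1 + 20 + 1`).

THE OBJECTS (all the tree's).  `A : AbelianVariety ℂ` with `A.X : SchemeOver ℂ`, `A.dim`, `AbelianVariety.finrank_bettiCohomology` (`b_k(A) = C(2 dim A, k)`);
`projectiveSpace N ℂ` with `isSmoothProjective_projectiveSpace'`, `hodgeTateType_projectiveSpace`, `finrank_bettiCohomology_projectiveSpace_two_mul`; `IsK3Surface S` with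
`IsK3Surface.hodgeNumber_hodge_two_two_zero` (`p_g = 1`, proved) and the two named facts of `Surfaces/` taken as hypotheses exactly as in g24-#12 —
`Huybrechts_K3_oddBetti_vanish` (only its `H¹`-half is used here) and `K3_finrank_complexBetti_two` (`b_2 = 22`); the displayed `E(X) = Σ_{k ∈ range (2n+1)} (−1)^k b_k(X; ℚ)`.

WHAT IS PROVED.
* §1 ABELIAN VARIETIES: `AbelianVariety.eulerChar_eq_alternating_sum_choose` (`E(A) = Σ_{k ≤ 2g} (−1)^k C(2g,k)`), **`AbelianVariety.eulerChar_eq_zero`** (`dim A ≥ 1 ⟹ E(A) = 0`),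
  `AbelianVariety.eulerChar_eq_one_of_dim_eq_zero` (`dim A = 0 ⟹ E(A) = 1`), `AbelianVariety.eulerChar_eq_zero_iff` (`E(A) = 0 ⟺ 1 ≤ dim A`).
* §2 PROJECTIVE SPACE: **`eulerChar_projectiveSpace`** (`E(ℙᴺ) = N + 1`, via g25-#1's Hodge–Tate formula `E = Σ_{p ≤ N} b_{2p}` and `b_{2p}(ℙᴺ) = 1`).
* §3 SURFACES WITH `p_g = q = 0` / REGULAR SURFACES: **`BettiUniverse.eulerChar_surface_of_pg_q_zero`** (`E(S) = 2 + h^{1,1}(S)`),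
  `BettiUniverse.eulerChar_surface_of_pg_q_zero_picard` (`= 2 + ρ(S)`, `ρ = dim_ℚ Hdg¹(H²(S))`); with `q = 0` alone: `BettiUniverse.eulerChar_surface_of_irregularity_zero`
  (`E(S) = 2 + b_2(S)`), `BettiUniverse.three_le_eulerChar_surface_of_irregularity_zero` (`E(S) ≥ 3`), `BettiUniverse.eulerChar_surface_eq_three_iff_of_irregularity_zero`
  (`E(S) = 3 ⟺ b_2 = 1`), `BettiUniverse.two_add_le_eulerChar_surface_of_irregularity_zero` (`E(S) ≥ 2 + 2p_g + ρ`).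
* §4 K3 SURFACES: `IsK3Surface.finrank_bettiCohomology_three_eq_zero_of_one` (`b_1 = 0 ⟹ b_3 = 0` by Poincaré duality — the `H³`-half of `Huybrechts_K3_oddBetti_vanish` follows from
  its `H¹`-half), `IsK3Surface.eulerChar_eq_four_add_hodgeNumber` (`E(S) = 4 + h^{1,1}(S)` given `H¹ = 0`), `IsK3Surface.eulerChar_eq_two_add_finrank` (`E(S) = 2 + b_2(S)` given `H¹ = 0`),
  **`IsK3Surface.eulerChar_eq_twentyfour`** (`E(S) = 1 + 22 + 1 = 24` given `H¹ = 0` and `b_2 = 22`), `IsK3Surface.eulerChar_eq_twentyfour_iff` (given `H¹ = 0`: `E(S) = 24 ⟺ b_2 = 22`).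

DEVIATIONS / SCOPE.  Nothing is defined.  The K3 statements stay conditional on the two `Surfaces/` facts exactly where g24-#12 is (GAGA for `H¹(S, 𝒪_S) = 0 ⟹ b_1 = 0` and
Noether's formula for `b_2 = 22` are not in the tree); the abelian-variety and `ℙᴺ` statements are unconditional.  Hypersurfaces and products are not touched.

## References
* [Yui2013] N. Yui, *Modularity of Calabi–Yau varieties: 2011 and beyond* (2013) — §1.4 Example 1 (a), (b) (held text p0221).
* [Lange2023AbelianVarietiesComplex] H. Lange, *Abelian Varieties over the Complex Numbers* (2023) — §1.1.3 Cor. 1.1.18 (PDF p. 27); §1.7.1 proof of Thm. 1.7.1 (PDF p. 72).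
* [Arapura2012] D. Arapura, *Algebraic Geometry over the Complex Numbers* (2012) — §4.5 Ex. 4.5.5 (PDF p. 95); §7.2 Thm. 7.2.2 (PDF p. 141); §11.1 and Example 11.1.1 (PDF p. 174);
  §11.2 (PDF p. 177).
* [Huybrechts2016K3] D. Huybrechts, *Lectures on K3 Surfaces* (2016) — Ch. 1 §2.4 (2.7), §3.3.
* [HatcherAT2002] A. Hatcher, *Algebraic Topology* (2002) — §3.3 Cor. 3.37.

## Provenance
Lane `lit-hodgefound` (Hodge path, Track 2), prover seat `lit-hodgefound-p29` (generation 25), self-proposed row g25-#2 (sequel of g25-#1 on the example carriers of g24-#6/#9/#12/#14).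
-/

noncomputable section

open scoped TensorProduct
open CategoryTheory Module Finset
open Literature.AlgebraicTopology.SingularHomology

namespace Literature.AlgebraicGeometry.HodgeTheory

open Literature.AlgebraicGeometry.Motives
open Literature.AlgebraicGeometry.Motives.HodgeStructure
open Literature.AlgebraicGeometry.Surfaces

/-! ### §1 Abelian varieties: `E(A) = Σ_k (−1)^k C(2g, k) = 0` -/

section AbelianVariety

variable (A : AbelianVariety ℂ)

/-- **`E(A) = Σ_{k ≤ 2g} (−1)^k C(2g, k)`** for a complex abelian variety `A` of dimension `g` (`b_k(A) = C(2g, k)`, the tree's `AbelianVariety.finrank_bettiCohomology`).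
[cite: Lange2023AbelianVarietiesComplex, §1.1.3 Cor. 1.1.18 (PDF p. 27)] [cite: Yui2013, §1.4 (held text p0221)] -/
theorem AbelianVariety.eulerChar_eq_alternating_sum_choose :
    ∑ k ∈ range (2 * A.dim + 1), (-1 : ℤ) ^ k * (Module.finrank ℚ (bettiCohomology A.X k) : ℤ) = ∑ k ∈ range (2 * A.dim + 1), (-1 : ℤ) ^ k * ((2 * A.dim).choose k : ℤ) :=
  Finset.sum_congr rfl fun k _ => by rw [AbelianVariety.finrank_bettiCohomology A k]

/-- **`E(A) = 0` for a complex abelian variety of positive dimension** (`Σ_{k ≤ 2g} (−1)^k C(2g, k) = (1 − 1)^{2g} = 0`, «the binomial formula»; `g = 1`: Yui's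
«`E(X) = B_0 − B_1 + B_2 = 0`»). [cite: Lange2023AbelianVarietiesComplex, §1.1.3 Cor. 1.1.18 (PDF p. 27) and §1.7.1 proof of Thm. 1.7.1 (PDF p. 72)]
[cite: Yui2013, §1.4 Example 1 (a) (held text p0221)] -/
theorem AbelianVariety.eulerChar_eq_zero (hg : 1 ≤ A.dim) : ∑ k ∈ range (2 * A.dim + 1), (-1 : ℤ) ^ k * (Module.finrank ℚ (bettiCohomology A.X k) : ℤ) = 0 := by
  rw [AbelianVariety.eulerChar_eq_alternating_sum_choose A]
  exact Int.alternating_sum_range_choose_of_ne (by omega)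

/-- `dim A = 0` (a point): `E(A) = b_0 = 1` («`C(0,0) = 1`»). [cite: Lange2023AbelianVarietiesComplex, §1.7.1 proof of Thm. 1.7.1 (PDF p. 72)] -/
theorem AbelianVariety.eulerChar_eq_one_of_dim_eq_zero (hg : A.dim = 0) :
    ∑ k ∈ range (2 * A.dim + 1), (-1 : ℤ) ^ k * (Module.finrank ℚ (bettiCohomology A.X k) : ℤ) = 1 := by
  rw [AbelianVariety.eulerChar_eq_alternating_sum_choose A, Int.alternating_sum_range_choose, if_pos (by omega)]

/-- **`E(A) = 0 ⟺ dim A ≥ 1`.** [cite: Lange2023AbelianVarietiesComplex, §1.1.3 Cor. 1.1.18 (PDF p. 27) and §1.7.1 proof of Thm. 1.7.1 (PDF p. 72)] -/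
theorem AbelianVariety.eulerChar_eq_zero_iff : ∑ k ∈ range (2 * A.dim + 1), (-1 : ℤ) ^ k * (Module.finrank ℚ (bettiCohomology A.X k) : ℤ) = 0 ↔ 1 ≤ A.dim := by
  refine ⟨fun h => ?_, AbelianVariety.eulerChar_eq_zero A⟩
  by_contra h0
  rw [AbelianVariety.eulerChar_eq_one_of_dim_eq_zero A (by omega)] at h
  exact one_ne_zero h

end AbelianVariety

/-! ### §2 Projective space: `E(ℙᴺ) = N + 1` -/

/-- **`E(ℙᴺ_ℂ) = N + 1`**: `ℙᴺ` is of Hodge–Tate type (g24-#14), so `E(ℙᴺ) = Σ_{p ≤ N} b_{2p}(ℙᴺ) = Σ_{p ≤ N} 1` (g25-#1 and `Hⁱ(ℙᴺ) = ℚ` for `i ≤ 2N` even, `0` otherwise).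
[cite: Arapura2012, §7.2 Thm. 7.2.2 (PDF p. 141) and §4.5 Exercise 4.5.5 (PDF p. 95)] [cite: HatcherAT2002, Thm. 3.19] -/
theorem eulerChar_projectiveSpace (N : ℕ) :
    ∑ k ∈ range (2 * N + 1), (-1 : ℤ) ^ k * (Module.finrank ℚ (bettiCohomology (projectiveSpace N ℂ) k) : ℤ) = N + 1 := by
  have hX := isSmoothProjective_projectiveSpace' N
  rw [BettiUniverse.eulerChar_eq_sum_finrank_of_hodgeTateType exists_isReal_hodgeModel_holds hX
    (hodgeTateType_projectiveSpace N exists_isReal_hodgeModel_holds hX)]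
  rw [Finset.sum_congr rfl fun p hp => by rw [finrank_bettiCohomology_projectiveSpace_two_mul N (show p ≤ N by have := Finset.mem_range.1 hp; omega)]]
  simp

/-! ### §3 Surfaces with `p_g = q = 0`: `E(S) = 2 + h^{1,1} = 2 + b_2 = 2 + ρ ≥ 3` -/

section Surface

variable {X : SchemeOver ℂ}

/-- **`p_g = q = 0` ⟹ `E(S) = 2 + h^{1,1}(S)`** (Arapura's `e = 2 − 4q + 2p_g + h^{11}`; Example 11.1.1: `ℙ²` has `q = p_g = 0`, `h^{11} = 1`, `e = 3`).
[cite: Arapura2012, §11.1 and Example 11.1.1 (PDF p. 174)] -/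
theorem BettiUniverse.eulerChar_surface_of_pg_q_zero (hHD : exists_isReal_hodgeModel) (hX : IsSmoothProjective 2 X)
    (h10 : (BettiUniverse.hodge hHD hX 1).hodgeNumber 1 0 = 0) (h20 : (BettiUniverse.hodge hHD hX 2).hodgeNumber 2 0 = 0) :
    ∑ k ∈ range (2 * 2 + 1), (-1 : ℤ) ^ k * (Module.finrank ℚ (bettiCohomology X k) : ℤ) = 2 + ((BettiUniverse.hodge hHD hX 2).hodgeNumber 1 1 : ℤ) := by
  rw [BettiUniverse.eulerChar_surface hHD hX, h10, h20]
  push_cast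
  ring

/-- **`p_g = q = 0` ⟹ `E(S) = 2 + ρ(S)`**, `ρ(S) = dim_ℚ Hdg¹(H²(S))` the Picard number (`ρ = h^{1,1}` when `p_g = 0`, g24-#10). [cite: Arapura2012, §11.1 (PDF p. 174) and §11.2 (PDF p. 177)] -/
theorem BettiUniverse.eulerChar_surface_of_pg_q_zero_picard (hHD : exists_isReal_hodgeModel) (hX : IsSmoothProjective 2 X)
    (h10 : (BettiUniverse.hodge hHD hX 1).hodgeNumber 1 0 = 0) (h20 : (BettiUniverse.hodge hHD hX 2).hodgeNumber 2 0 = 0) :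
    ∑ k ∈ range (2 * 2 + 1), (-1 : ℤ) ^ k * (Module.finrank ℚ (bettiCohomology X k) : ℤ) =
      2 + (Module.finrank ℚ ((BettiUniverse.hodge hHD hX 2).hodgeClasses 1) : ℤ) := by
  rw [BettiUniverse.eulerChar_surface_of_pg_q_zero hHD hX h10 h20, BettiUniverse.finrank_hodgeClasses_hodge_two_eq_hodgeNumber_of_pg_zero hHD hX h20]

/-- **`q = 0` alone ⟹ `E(S) = 2 + b_2(S)`** (`b_1 = b_3 = 2q = 0`, `b_0 = b_4 = 1`; regular surfaces). [cite: Arapura2012, §11.1 (PDF p. 174)] -/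
theorem BettiUniverse.eulerChar_surface_of_irregularity_zero (hHD : exists_isReal_hodgeModel) (hX : IsSmoothProjective 2 X)
    (h10 : (BettiUniverse.hodge hHD hX 1).hodgeNumber 1 0 = 0) :
    ∑ k ∈ range (2 * 2 + 1), (-1 : ℤ) ^ k * (Module.finrank ℚ (bettiCohomology X k) : ℤ) = 2 + (Module.finrank ℚ (bettiCohomology X 2) : ℤ) := by
  rw [BettiUniverse.eulerChar_surface_betti hX, BettiUniverse.finrank_bettiCohomology_one_eq_two_mul hHD hX, h10]
  push_cast
  ring

/-- **`q = 0` ⟹ `E(S) ≥ 3`** (`b_2 ≥ ρ ≥ 1`: the hyperplane class; `E(ℙ²) = 3`). [cite: Arapura2012, §11.1 and Example 11.1.1 (PDF p. 174) and §11.2 (PDF p. 177)] -/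
theorem BettiUniverse.three_le_eulerChar_surface_of_irregularity_zero (hHD : exists_isReal_hodgeModel) (hX : IsSmoothProjective 2 X)
    (h10 : (BettiUniverse.hodge hHD hX 1).hodgeNumber 1 0 = 0) :
    (3 : ℤ) ≤ ∑ k ∈ range (2 * 2 + 1), (-1 : ℤ) ^ k * (Module.finrank ℚ (bettiCohomology X k) : ℤ) := by
  rw [BettiUniverse.eulerChar_surface_of_irregularity_zero hHD hX h10]
  have h1 := BettiUniverse.one_le_finrank_hodgeClasses_hodge_two hHD hX (show 1 ≤ 2 by omega)
  have h2 := BettiUniverse.finrank_hodgeClasses_hodge_two_add_two_mul_le hHD hX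
  omega

/-- **`q = 0`: `E(S) = 3 ⟺ b_2(S) = 1`** (the case of `ℙ²`). [cite: Arapura2012, §11.1 Example 11.1.1 (PDF p. 174)] -/
theorem BettiUniverse.eulerChar_surface_eq_three_iff_of_irregularity_zero (hHD : exists_isReal_hodgeModel) (hX : IsSmoothProjective 2 X)
    (h10 : (BettiUniverse.hodge hHD hX 1).hodgeNumber 1 0 = 0) :
    ∑ k ∈ range (2 * 2 + 1), (-1 : ℤ) ^ k * (Module.finrank ℚ (bettiCohomology X k) : ℤ) = 3 ↔ Module.finrank ℚ (bettiCohomology X 2) = 1 := by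
  rw [BettiUniverse.eulerChar_surface_of_irregularity_zero hHD hX h10]
  omega

/-- **`q = 0` ⟹ `E(S) ≥ 2 + 2p_g(S) + ρ(S)`** (`E = 2 + b_2` and `ρ + 2p_g ≤ b_2`, i.e. `ρ ≤ h^{1,1}`). [cite: Arapura2012, §11.1 (PDF p. 174) and §11.2 (PDF p. 177)] -/
theorem BettiUniverse.two_add_le_eulerChar_surface_of_irregularity_zero (hHD : exists_isReal_hodgeModel) (hX : IsSmoothProjective 2 X)
    (h10 : (BettiUniverse.hodge hHD hX 1).hodgeNumber 1 0 = 0) :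
    2 + 2 * ((BettiUniverse.hodge hHD hX 2).hodgeNumber 2 0 : ℤ) + (Module.finrank ℚ ((BettiUniverse.hodge hHD hX 2).hodgeClasses 1) : ℤ) ≤
      ∑ k ∈ range (2 * 2 + 1), (-1 : ℤ) ^ k * (Module.finrank ℚ (bettiCohomology X k) : ℤ) := by
  rw [BettiUniverse.eulerChar_surface_of_irregularity_zero hHD hX h10]
  have h2 := BettiUniverse.finrank_hodgeClasses_hodge_two_add_two_mul_le hHD hX
  omega

end Surface

/-! ### §4 K3 surfaces: `b_3 = b_1 = 0`, `E(S) = 4 + h^{1,1} = 2 + b_2 = 1 + 22 + 1 = 24` -/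

section K3

variable {S : SchemeOver ℂ}

/-- **`H¹(S(ℂ); ℚ) = 0 ⟹ H³(S(ℂ); ℚ) = 0` for a K3 surface** (`b_3 = b_1` by Poincaré duality: the `H³`-half of the fact `Huybrechts_K3_oddBetti_vanish` follows from its `H¹`-half).
[cite: Huybrechts2016K3, Ch. 1 §3.3] [cite: HatcherAT2002, §3.3 Cor. 3.37] -/
theorem _root_.Literature.AlgebraicGeometry.Surfaces.IsK3Surface.finrank_bettiCohomology_three_eq_zero_of_one (hS : IsK3Surface S)
    (h1 : Module.finrank ℚ (bettiCohomology S 1) = 0) : Module.finrank ℚ (bettiCohomology S 3) = 0 := by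
  rw [BettiUniverse.finrank_bettiCohomology_eq_of_add_eq hS.isSmoothProjective (show 3 + 1 = 2 * 2 by ring), h1]

/-- **K3: `E(S) = 4 + h^{1,1}(S)`** given `H¹ = 0` (`q = 0`; `p_g = 1` is proved for `IsK3Surface`: g25-#1's K3 pattern). [cite: Yui2013, §1.4 Example 1 (b) (held text p0221)]
[cite: Huybrechts2016K3, Ch. 1 §2.4 (2.7) and §3.3] -/
theorem _root_.Literature.AlgebraicGeometry.Surfaces.IsK3Surface.eulerChar_eq_four_add_hodgeNumber (hS : IsK3Surface S) (h : Huybrechts_K3_oddBetti_vanish)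
    (hHD : exists_isReal_hodgeModel) (hX : IsSmoothProjective 2 S) :
    ∑ k ∈ range (2 * 2 + 1), (-1 : ℤ) ^ k * (Module.finrank ℚ (bettiCohomology S k) : ℤ) = 4 + ((BettiUniverse.hodge hHD hX 2).hodgeNumber 1 1 : ℤ) :=
  BettiUniverse.eulerChar_surface_of_irregularity_zero_pg_one hHD hX (hS.hodgeNumber_hodge_one_one_zero h hHD hX) (hS.hodgeNumber_hodge_two_two_zero hHD hX)

/-- **K3: `E(S) = 2 + b_2(S)`** given `H¹ = 0` (`b_0 = b_4 = 1`, `b_1 = b_3 = 0`). [cite: Yui2013, §1.4 Example 1 (b) (held text p0221)] [cite: Huybrechts2016K3, Ch. 1 §3.3] -/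
theorem _root_.Literature.AlgebraicGeometry.Surfaces.IsK3Surface.eulerChar_eq_two_add_finrank (hS : IsK3Surface S) (h : Huybrechts_K3_oddBetti_vanish) :
    ∑ k ∈ range (2 * 2 + 1), (-1 : ℤ) ^ k * (Module.finrank ℚ (bettiCohomology S k) : ℤ) = 2 + (Module.finrank ℚ (bettiCohomology S 2) : ℤ) := by
  rw [BettiUniverse.eulerChar_surface_betti hS.isSmoothProjective, hS.finrank_bettiCohomology_one_eq_zero h]
  push_cast
  ring

/-- **K3: `E(S) = Σ_{k=0}^{4} (−1)^k B_k(S) = 1 + 22 + 1 = 24`**, given the two `Surfaces/` facts `H¹ = 0` and `b_2 = 22`. [cite: Yui2013, §1.4 Example 1 (b) (held text p0221)]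
[cite: Huybrechts2016K3, Ch. 1 §2.4 (2.7) and §3.3] -/
theorem _root_.Literature.AlgebraicGeometry.Surfaces.IsK3Surface.eulerChar_eq_twentyfour (hS : IsK3Surface S) (h : Huybrechts_K3_oddBetti_vanish)
    (h22 : K3_finrank_complexBetti_two) : ∑ k ∈ range (2 * 2 + 1), (-1 : ℤ) ^ k * (Module.finrank ℚ (bettiCohomology S k) : ℤ) = 24 := by
  rw [hS.eulerChar_eq_two_add_finrank h, hS.finrank_bettiCohomology_two h22]
  norm_num

/-- **K3, given `H¹ = 0`: `E(S) = 24 ⟺ b_2(S) = 22`** (the Betti number `b_2 = 22` and the Euler number `24` are the same datum). [cite: Yui2013, §1.4 Example 1 (b) (held text p0221)]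
[cite: Huybrechts2016K3, Ch. 1 §2.4 (2.7)] -/
theorem _root_.Literature.AlgebraicGeometry.Surfaces.IsK3Surface.eulerChar_eq_twentyfour_iff (hS : IsK3Surface S) (h : Huybrechts_K3_oddBetti_vanish) :
    ∑ k ∈ range (2 * 2 + 1), (-1 : ℤ) ^ k * (Module.finrank ℚ (bettiCohomology S k) : ℤ) = 24 ↔ Module.finrank ℚ (bettiCohomology S 2) = 22 := by
  rw [hS.eulerChar_eq_two_add_finrank h]
  omega

end K3

end Literature.AlgebraicGeometry.HodgeTheory

end
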